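import Literature.MathematicalPhysics.QuantumFieldTheory.Balaban1983to89.B8Ineq159PeriodizedTowerSourceReads
import Literature.MathematicalPhysics.QuantumFieldTheory.Balaban1983to89.B8Ineq159TopCubeTowerSourcePoint

/-!
# `Balaban1983to89.B8Ineq159PeriodizedTowerSourcePoint` — [Balaban1985RegularSpaces] (1.146) p. 101, (1.59) p. 86, (1.131) p. 99, p. 77 («Ω_j = T_η»): A FIELD IN THE
# SOURCED LANDAU GAUGE (1.146) OVER THE PERIODISED SECT.-F TOWER `Ωᴾ = periodize (fun _ ↦ P) (cubeFam true L a M ρ k)` IS POINTWISE BOUNDED BY ITS CURRENT, ITS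
# CLASS AVERAGES AND THE SOURCE — this lineage's g4 `exists_pointBound_src_topCube`, translate-wise (constants per shape: independent of `P`, `a`, `η`)

statement-level skeleton of published theorems with citation tags; proofs where landed; nothing here is a claim about the
Yang–Mills mass gap

`[Balaban1985RegularSpaces]` ("B8", CMP **99** (1985) 75–102) (1.1) p. 76, (1.7) p. 77, (1.31) p. 82, (1.38) p. 82, (1.59) p. 86, (1.131) p. 99, (1.146) p. 101, p. 98,
p. 77 («Ω_j = T_η»); [4] = `[Balaban1985BackgroundPropagators]` Thm 3.3 p. 399, (3.23)–(3.25) p. 394; [B6] = `[Balaban1984PropagatorsII]` (2.1)–(2.3) p. 224; [B7] =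
`[Balaban1985Averaging]` (127) p. 37, Prop. 5 p. 42.

CITATION HEADER (lean-in-tree rule).  Cell `pub-ymgap` (YM Track A, HUMAN RULING D-0062 ∕ D-0149), DAG node N05 = [B8], width seat `pub-ymgap-dag-n05-w3` (g5),
CLAIM-2 file (D2).  WHY.  The sourced b9-socket of Proposition 3's frame (`SB9srcHP`, Theorem 8's input letter) at the periodised Sect.-F tower needs the sourced
pointwise bound; this file is g4's `B8Ineq159TopCubeTowerSourcePoint.exists_pointBound_src_topCube` run TRANSLATE BY TRANSLATE: at each translate `□₀(a + q•v)` the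
source is cancelled by g4's line-integral divergence potential (`exists_divPotential`) cut off to the sides of the plaquettes touching that cube, the sourced Landau
condition is transferred by file (D1), the per-cube curved (1.59) of file (U) (UNIFORM IN THE POSITION) bounds the remainder, and the level-`0` class bonds of `Ωᴾ` (files
(A1)∕(A2)) read `ηA′` everywhere else.

THE MATHEMATICS (kernel-checked).  ★★ `exists_pointBound_src_periodize`: for `d ≥ 2`, `2 ≤ L ≤ ρ`, `k ≥ 1`, finite-dimensional `𝔹`: `∃ cP3 ∈ (0, ½], P₀ ≥ 1, P₁ > 0`
(shape-dependent) such that for every centre `a`, spacing `η > 0`, period `P = Lᵏ·q` with `Lᵏ·M + 2·ρ·gs L k ≤ P`, `Ω = Ωᴾ`, restriction family `Λ = Lam L Ωᴾ k` up to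
the depth, unitary `U₀ ∈ 𝔄_k(Ωᴾ, cP3)`, a bond field `A′` and a source `f` with `‖f‖ ≤ s·η⁻²` satisfying the multiplier clause of (1.146), and every `N ≥ 0` dominating
`(Lʲη)³|J(A′)|` on the bonds touching `Ωᴾ_j` and the class averages of `iηA′` over `towerBondsP L Ωᴾ Λ`: `η‖A′‖ ≤ P₀N + P₁s` EVERYWHERE and `Lʲη‖A′‖ ≤ P₀N + P₁s` on the
sides of the plaquettes touching any translate's `□_j(a + q•v)`, `1 ≤ j ≤ k`.

HONEST SCOPE.  Per-SHAPE constants (`cP3 = min{α₀(□), ½, α_Q∕L²}`, `P₀ = B″+1`, `P₁ = B″C_φ + LᵏW + 1`, `W = LᵏM + 2ρ·gs L k + 2`): NOT [4] Thm 3.3 with source (N06);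
no letter of [4] assumed or proved; the hypotheses `f ∈ R(U₀)`, self-adjointness, `A′` small are not used here (they enter the socket text only); count-neutral; N05 NOT
discharged; one finite `𝕋⁴` programme at fixed `ε`, Bałaban as printed; the YM mass gap (Clay) is NOT proved by any of this — R4 closes the conditional finite-`𝕋⁴`
rung `BalabanLadder.UV` only; nothing continuum ∕ ℝ⁴ ∕ OS.  No `sorry`, no `def`, no `instance`, no `notation`.  Unit `pub-ymgap-dag-n05-w3` (g5), 2026-08-28.
-/

noncomputable section

namespace Literature.MathematicalPhysics.QuantumFieldTheory.Balaban1983to89.B8Ineq159PeriodizedTowerSourcePoint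

open B7Prop1Explicit B7Prop2Explicit B7Prop1Local B7Eq78Linearization
open B7Prop4GeneralLevels (linCovIter)
open B7Prop5GeneralLevels (thetaGen)
open B8Ineq132 (covDerivFwd BondTouches InAk)
open B8Eq140Level (SideTouches sideTouches_of_bondTouches sideTouches_mono)
open B8Eq146AExpansion (iEta norm_I_eta_smul)
open B8Eq155JBound (Jcur)
open B8Eq138LandauZd (IsLandau138 QT covLap covDivB)
open B8Eq131CubesAdmissible (cubeFam cubeFam_true_zero cubeFam_false_zero cubeFam_false_of_le cubeFam_of_pos)
open B8Eq131Cubes (cube cube_anti sqLo sqHi bLo bHi gs)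
open B8CubeMemberZd (cubeLamS)
open B8Ineq159FlatCubeMemberPrinted (cubeLamBP cubeLamBP_box_subset_pred)
open B8TowerBondsPrinted (towerBondsP)
open B9Ineq3137LocalSup (linCovIter_congr)
open B9Eq316AveragingTransposeZd (alphaQ alphaQ_pos)
open B9SupplySockB9P3ZdSocketBoundaryMode (exists_ne_fin)
open B9SupplySockB9P3ZdLettersOmega (Jcur_add)
open B8Ineq159CurvedCubeMemberUniform (exists_curved159_perCube_inAk_sup_unitary_uniform)
open B8Ineq159TopCubeTowerReads (Jcur_congr_fld_touch covDivB_congr_fld towerBondsP_congr_levels)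
open B8Ineq159TopCubeTowerSourceReads (exists_divPotential norm_linCovIter_cubeLamBP_le linCovIter_sub_cubeLamBP)
open B8Ineq159TopCubeTowerSourcePoint (iEta_sub toNat_le_width_of_sideTouches)
open B8Prop7GlevZd3 (inAk_mono_alpha)
open B15LatticeCubeTorus (periodize)
open B8Ineq159PeriodizedTowerReads B8Ineq159PeriodizedTowerClass B8Ineq159PeriodizedTowerSourceReads

-- `Site` alone would resolve to the torus sites of `Setup.lean`; re-export the `ℤ^d` sites of `B7Prop1Explicit`.
export B7Prop1Explicit (Site)

variable {d : ℕ} {𝔹 : Type*} [CStarAlgebra 𝔹] [Nontrivial 𝔹]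

/-- ★★ **A FIELD IN THE SOURCED LANDAU GAUGE (1.146) OVER THE PERIODISED SECT.-F TOWER IS POINTWISE BOUNDED BY ITS CURRENT, ITS CLASS AVERAGES AND THE SOURCE**, per
shape: `∃ cP3 ∈ (0, ½]` with `cP3·L² ≤ α_Q` ([B7] Prop. 5's regime, exported for the socket file), `P₀ ≥ 1, P₁ > 0` before `∀ a η P Ω Λ U₀ A′ f s N` (see the module docstring).  g4's `exists_pointBound_src_topCube` translate-wise; the per-cube
constants `(α₀, B″)` of file (U) do not see the position, so every translate `□₀(a + q•v)` is served by the same pair.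
[cite: Balaban1985RegularSpaces, (1.146) p.101, (1.59) p.86, (1.38) p.82, (1.31) p.82, (1.131) p.99, (1.7) p.77, (1.1) p.76, p.77 («Ω_j = T_η»); Balaban1985BackgroundPropagators, Thm 3.3 p.399, (3.23)–(3.25) p.394; Balaban1984PropagatorsII, (2.1)–(2.3) p.224; Balaban1985Averaging, (127) p.37, Prop. 5 p.42] -/
theorem exists_pointBound_src_periodize [FiniteDimensional ℂ 𝔹] (hd2 : 2 ≤ d) {L : ℕ} (hL2 : 2 ≤ L) (M : ℕ) {ρ : ℕ} (hρ : L ≤ ρ)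
    {k : ℕ} (hk : 1 ≤ k) :
    ∃ cP3 P₀ P₁ : ℝ, 0 < cP3 ∧ cP3 ≤ 1 / 2 ∧ cP3 * (L : ℝ) ^ 2 ≤ alphaQ d L ∧ 1 ≤ P₀ ∧ 0 < P₁ ∧ ∀ (a : Site d) (η : ℝ), 0 < η →
      ∀ (P : ℕ) (q : ℤ), (L : ℤ) ^ k * q = P → L ^ k * M + 2 * (ρ * gs L k) ≤ P →
      ∀ (Ω : ℕ → Set (Site d)) (Λ : ℕ → Set (Site d)), Ω = periodize (fun _ : Fin d => P) (cubeFam true L a M ρ k) →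
      (∀ j, j ≤ k → Λ j = B11Eq7Convention.Lam L Ω k j) →
      ∀ U₀ : Site d → Fin d → 𝔹ˣ, (∀ x κ, U₀ x κ ∈ unitaryUnits 𝔹) → InAk L k η cP3 Ω U₀ →
      ∀ (A' : Site d → Fin d → 𝔹) (f : Site d → 𝔹) (s : ℝ), 0 ≤ s → (∀ x, ‖f x‖ ≤ s * (η ^ 2)⁻¹) →
      (∃ μ : ℕ → Site d → 𝔹, ∀ x, covLap η U₀ (fun z => covDivB η U₀ A' z - f z) x = QT L k Λ U₀ μ x) →
      ∀ N : ℝ, 0 ≤ N →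
      (∀ j, j ≤ k → ∀ (x : Site d) (μ : Fin d), BondTouches (Ω j) x μ → ((L : ℝ) ^ j * η) ^ 3 * ‖Jcur η U₀ A' μ x‖ ≤ N) →
      (∀ j, j ≤ k → ∀ c ∈ towerBondsP L Ω Λ j, ‖linCovIter L U₀ (iEta η A') j c.1 c.2‖ ≤ N) →
      (∀ (y : Site d) (τ : Fin d), η * ‖A' y τ‖ ≤ P₀ * N + P₁ * s) ∧
      (∀ j, 1 ≤ j → j ≤ k → ∀ (v y : Site d) (τ : Fin d), SideTouches (cube L (a + q • v) M ρ k j) y τ →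
        (L : ℝ) ^ j * η * ‖A' y τ‖ ≤ P₀ * N + P₁ * s) := by
  classical
  obtain ⟨α₀, B'', hα₀, hB'', H⟩ := exists_curved159_perCube_inAk_sup_unitary_uniform (𝔹 := 𝔹) hd2 hL2 M hρ (k := k) (m := k) hk le_rfl
  have hL1 : 1 ≤ L := le_trans (by norm_num) hL2
  have hρ1 : 1 ≤ ρ := hL1.trans hρ
  have hL1r : (1 : ℝ) ≤ L := by exact_mod_cast hL1
  have hLk1 : (1 : ℝ) ≤ (L : ℝ) ^ k := one_le_pow₀ hL1r
  have hd1 : (1 : ℝ) ≤ d := by exact_mod_cast (le_trans (by norm_num) hd2 : 1 ≤ d)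
  -- the constants (g4's, verbatim: they do not see the position)
  obtain ⟨cP3, hcP3⟩ : ∃ c : ℝ, c = min (min α₀ (1 / 2)) (alphaQ d L / (L : ℝ) ^ 2) := ⟨_, rfl⟩
  have hcP3pos : 0 < cP3 := by rw [hcP3]; exact lt_min (lt_min hα₀ (by norm_num)) (div_pos (alphaQ_pos d hL1) (by positivity))
  have hcP3α : cP3 ≤ α₀ := by rw [hcP3]; exact (min_le_left _ _).trans (min_le_left _ _)
  have hcP3h : cP3 ≤ 1 / 2 := by rw [hcP3]; exact (min_le_left _ _).trans (min_le_right _ _)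
  have hcP3Q : cP3 * (L : ℝ) ^ 2 ≤ alphaQ d L := by
    have h : cP3 ≤ alphaQ d L / (L : ℝ) ^ 2 := by rw [hcP3]; exact min_le_right _ _
    calc cP3 * (L : ℝ) ^ 2 ≤ alphaQ d L / (L : ℝ) ^ 2 * (L : ℝ) ^ 2 := mul_le_mul_of_nonneg_right h (by positivity)
      _ = alphaQ d L := div_mul_cancel₀ _ (by positivity)
  have hθ0 : 0 ≤ thetaGen d L (cP3 * (L : ℝ) ^ 2) := by unfold thetaGen; positivity
  obtain ⟨Wd, hWd⟩ : ∃ w : ℝ, w = ((L ^ k * M + 2 * (ρ * gs L k) + 2 : ℕ) : ℝ) := ⟨_, rfl⟩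
  have hWd0 : 0 ≤ Wd := by rw [hWd]; positivity
  obtain ⟨Cφ, hCφ⟩ : ∃ c : ℝ, c = 16 * d * (1 + thetaGen d L (cP3 * (L : ℝ) ^ 2)) * ((L : ℝ) ^ k) ^ 3 * Wd := ⟨_, rfl⟩
  have hCφ0 : 0 ≤ Cφ := by rw [hCφ]; positivity
  have h16 : (1 : ℝ) ≤ 16 * d * (1 + thetaGen d L (cP3 * (L : ℝ) ^ 2)) * ((L : ℝ) ^ k) ^ 3 :=
    one_le_mul_of_one_le_of_one_le (one_le_mul_of_one_le_of_one_le (by linarith) (by linarith)) (one_le_pow₀ hLk1)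
  have hWdC : Wd ≤ Cφ := by
    rw [hCφ]
    calc Wd = 1 * Wd := (one_mul _).symm
      _ ≤ 16 * d * (1 + thetaGen d L (cP3 * (L : ℝ) ^ 2)) * ((L : ℝ) ^ k) ^ 3 * Wd := mul_le_mul_of_nonneg_right h16 hWd0
  have hC16 : 16 * d * ((L : ℝ) ^ k) ^ 3 * Wd ≤ Cφ := by
    rw [hCφ]
    have h1 : 16 * (d : ℝ) * ((L : ℝ) ^ k) ^ 3 * Wd * 1 ≤ 16 * d * ((L : ℝ) ^ k) ^ 3 * Wd * (1 + thetaGen d L (cP3 * (L : ℝ) ^ 2)) :=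
      mul_le_mul_of_nonneg_left (by linarith) (by positivity)
    linarith
  have hC2 : ∀ j, j ≤ k → 2 * d * ((1 + thetaGen d L (cP3 * (L : ℝ) ^ 2)) * (L : ℝ) ^ j) * Wd ≤ Cφ := by
    intro j hj
    have hLj : (L : ℝ) ^ j ≤ ((L : ℝ) ^ k) ^ 3 := (pow_le_pow_right₀ hL1r hj).trans (le_self_pow₀ hLk1 (by norm_num))
    rw [hCφ]
    calc 2 * (d : ℝ) * ((1 + thetaGen d L (cP3 * (L : ℝ) ^ 2)) * (L : ℝ) ^ j) * Wd
        = 2 * ((d : ℝ) * (1 + thetaGen d L (cP3 * (L : ℝ) ^ 2)) * Wd * (L : ℝ) ^ j) := by ring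
      _ ≤ 16 * ((d : ℝ) * (1 + thetaGen d L (cP3 * (L : ℝ) ^ 2)) * Wd * ((L : ℝ) ^ k) ^ 3) := by gcongr; norm_num
      _ = 16 * d * (1 + thetaGen d L (cP3 * (L : ℝ) ^ 2)) * ((L : ℝ) ^ k) ^ 3 * Wd := by ring
  obtain ⟨P₀, hP₀⟩ : ∃ p : ℝ, p = B'' + 1 := ⟨_, rfl⟩
  have hP₀0 : 0 < P₀ := by rw [hP₀]; positivity
  have hBP : B'' ≤ P₀ := by rw [hP₀]; linarith
  have h1P : 1 ≤ P₀ := by rw [hP₀]; linarith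
  obtain ⟨P₁, hP₁⟩ : ∃ p : ℝ, p = B'' * Cφ + (L : ℝ) ^ k * Wd + 1 := ⟨_, rfl⟩
  have hP₁0 : 0 < P₁ := by rw [hP₁]; positivity
  have hP₁b : B'' * Cφ + (L : ℝ) ^ k * Wd ≤ P₁ := by rw [hP₁]; linarith
  refine ⟨cP3, P₀, P₁, hcP3pos, hcP3h, hcP3Q, h1P, hP₁0, ?_⟩
  intro a η hη P q hq hP Ω Λ hΩ hΛ U₀ hU₀ hAkc A' f s hs0 hfpt hLan' N hN0 hNJ hNavg
  subst hΩ
  set Ω : ℕ → Set (Site d) := periodize (fun _ : Fin d => P) (cubeFam true L a M ρ k) with hΩdef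
  have hU1 : ∀ x κ, U₀ x κ ∈ U1 𝔹 := fun x κ => unitaryUnits_le_U1 (hU₀ x κ)
  have hηne : η ≠ 0 := hη.ne'
  have hΩ0 : Ω 0 = Set.univ := periodize_cubeFam_true_zero P L a M ρ k
  have hAk0 : InAk L k η α₀ Ω U₀ := inAk_mono_alpha hη hcP3α hAkc
  -- the restriction family IS print's level-set family of `Ω` up to the depth
  have hTB : ∀ j, j ≤ k → towerBondsP L Ω Λ j = towerBondsP L Ω (B11Eq7Convention.Lam L Ω k) j := fun j hj =>
    towerBondsP_congr_levels L Ω j (hΛ j hj) (hΛ (j - 1) (by omega))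
  have hNavgL : ∀ j, j ≤ k → ∀ c ∈ towerBondsP L Ω (B11Eq7Convention.Lam L Ω k) j, ‖linCovIter L U₀ (iEta η A') j c.1 c.2‖ ≤ N :=
    fun j hj c hc => hNavg j hj c (by rw [hTB j hj]; exact hc)
  have hLanL : ∃ μ : ℕ → Site d → 𝔹, ∀ x, covLap η U₀ (fun z => covDivB η U₀ A' z - f z) x = QT L k (B11Eq7Convention.Lam L Ω k) U₀ μ x := by
    obtain ⟨μ, hμ⟩ := hLan'
    refine ⟨μ, fun x => ?_⟩
    rw [hμ x]
    unfold QT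
    exact Finset.sum_congr rfl fun j hj => by rw [hΛ j (Nat.lt_succ_iff.mp (Finset.mem_range.mp hj))]
  -- ★ THE PER-TRANSLATE ANALYSIS: `Lʲη|A′| ≤ B″N + (B″C_φ + LᵏW)s` on the sides of the plaquettes touching `□_j(a + q•v)`, `j ≥ 1`
  have LEV : ∀ (v : Site d) (j : ℕ), 1 ≤ j → j ≤ k → ∀ (y : Site d) (τ : Fin d), SideTouches (cube L (a + q • v) M ρ k j) y τ →
      (L : ℝ) ^ j * η * ‖A' y τ‖ ≤ B'' * N + (B'' * Cφ + (L : ℝ) ^ k * Wd) * s := by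
    intro v j hj1 hjk y τ hs
    have hAkcv : InAk L k η cP3 (cubeFam true L (a + q • v) M ρ k) U₀ := inAk_translate_of_periodize a M ρ k hq v hAkc
    have hsub : cubeFam false L (a + q • v) M ρ k 0 ⊆ Ω 0 := by rw [hΩ0]; exact Set.subset_univ _
    have hbt : ∀ (y : Site d) (τ : Fin d), BondTouches (cube L (a + q • v) M ρ k 0) y τ → SideTouches (cube L (a + q • v) M ρ k 0) y τ :=
      fun y τ hb => by
        obtain ⟨κ, hκ⟩ := exists_ne_fin hd2 τ
        exact sideTouches_of_bondTouches hκ hb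
    -- (1) the divergence potential of `f` from this cube's lower face, cut off to the sides `S` of the plaquettes touching `□₀(a + q•v)`
    obtain ⟨i₀, hi₀⟩ : ∃ i : Fin d, i = ⟨0, by omega⟩ := ⟨_, rfl⟩
    obtain ⟨A'', -, -, hdivA, hAbnd⟩ :=
      exists_divPotential hη hU1 i₀ (sqLo L (a + q • v) ρ k 0 i₀) f (b := s * (η ^ 2)⁻¹) (by positivity) hfpt
    obtain ⟨A3, hA3⟩ : ∃ B : Site d → Fin d → 𝔹, B = fun y τ => if SideTouches (cube L (a + q • v) M ρ k 0) y τ then A'' y τ else 0 := ⟨_, rfl⟩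
    have hA3S : ∀ (y : Site d) (τ : Fin d), SideTouches (cube L (a + q • v) M ρ k 0) y τ → A3 y τ = A'' y τ := fun y τ h => by
      rw [hA3]; exact if_pos h
    have hA3N : ∀ (y : Site d) (τ : Fin d), ¬ SideTouches (cube L (a + q • v) M ρ k 0) y τ → A3 y τ = 0 := fun y τ h => by
      rw [hA3]; exact if_neg h
    have hA3η : ∀ (y : Site d) (τ : Fin d), η * ‖A3 y τ‖ ≤ Wd * s := by
      intro y τ
      by_cases h : SideTouches (cube L (a + q • v) M ρ k 0) y τ
      · rw [hA3S y τ h]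
        have hw : ((y i₀ - sqLo L (a + q • v) ρ k 0 i₀ + 1).toNat : ℝ) ≤ Wd := by
          rw [hWd]; exact_mod_cast toNat_le_width_of_sideTouches L (a + q • v) M ρ k i₀ h
        calc η * ‖A'' y τ‖ ≤ η * (((y i₀ - sqLo L (a + q • v) ρ k 0 i₀ + 1).toNat : ℝ) * (η * (s * (η ^ 2)⁻¹))) :=
              mul_le_mul_of_nonneg_left (hAbnd y τ) hη.le
          _ = ((y i₀ - sqLo L (a + q • v) ρ k 0 i₀ + 1).toNat : ℝ) * s := by field_simp
          _ ≤ Wd * s := mul_le_mul_of_nonneg_right hw hs0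
      · rw [hA3N y τ h, norm_zero, mul_zero]; positivity
    have hA3b : ∀ (y : Site d) (τ : Fin d), ‖A3 y τ‖ ≤ Wd * s * η⁻¹ := fun y τ => by
      rw [le_mul_inv_iff₀ hη, mul_comm]; exact hA3η y τ
    have hdiv3 : ∀ x, x ∈ cube L (a + q • v) M ρ k 0 → covDivB η U₀ A3 x = f x := by
      intro x hx
      rw [← hdivA x (hx i₀).1]
      exact covDivB_congr_fld x (fun ν => hA3S _ _ (hbt _ _ (Or.inr (by rw [sub_add_cancel]; exact hx))))
        (fun ν => hA3S _ _ (hbt _ _ (Or.inl hx)))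
    -- (2) `φ := 𝟙_S(A′ − A″)` is in the translate cube member's (sourceless) Landau gauge
    obtain ⟨φ, hφ⟩ : ∃ B : Site d → Fin d → 𝔹, B = fun y τ => if SideTouches (cube L (a + q • v) M ρ k 0) y τ then A' y τ - A3 y τ else 0 :=
      ⟨_, rfl⟩
    have hφS : ∀ (y : Site d) (τ : Fin d), SideTouches (cube L (a + q • v) M ρ k 0) y τ → φ y τ = A' y τ - A3 y τ := fun y τ h => by
      rw [hφ]; exact if_pos h
    have hφN : ∀ (y : Site d) (τ : Fin d), ¬ SideTouches (cube L (a + q • v) M ρ k 0) y τ → φ y τ = 0 := fun y τ h => by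
      rw [hφ]; exact if_neg h
    have hφS' : ∀ (y : Site d) (τ : Fin d), SideTouches (cube L (a + q • v) M ρ k 0) y τ → φ y τ = (A' - A3) y τ := fun y τ h => by
      rw [hφS y τ h, Pi.sub_apply, Pi.sub_apply]
    have hLanφ : IsLandau138 L k η (cubeFam false L (a + q • v) M ρ k 0) (cubeLamS L (a + q • v) M ρ k k) U₀ φ :=
      isLandau138_cube_of_periodize_source hL1 a M hρ hq hP hk v (A := A') (A' := φ) (A'' := A3)
        (fun y τ hb => hφS y τ (hbt y τ hb)) hdiv3 hLanL
    have hφ0 : ∀ (y : Site d) (τ : Fin d), (∀ j, j ≤ k → ¬ SideTouches (cubeFam false L (a + q • v) M ρ k j) y τ) → φ y τ = 0 :=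
      fun y τ h => hφN y τ (by have h0 := h 0 (Nat.zero_le k); rwa [cubeFam_false_zero] at h0)
    -- (3) the current and the class averages of the cut-off potential
    have hJ3 : ∀ (μ : Fin d) (x : Site d), ‖Jcur η U₀ A3 μ x‖ ≤ 8 * d * (η⁻¹ * (η⁻¹ * (Wd * s * η⁻¹ + Wd * s * η⁻¹))) := by
      intro μ x
      refine B9SupplySockB9P3Zd.norm_Jcur_le_of_grad hη hU1 (fun y κ τ => ?_) μ x
      exact (B8Ineq159StencilsNearFlat.norm_covDerivFwd_le hU1 hη κ (fun z => A3 z τ) y).trans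
        (mul_le_mul_of_nonneg_left (add_le_add (hA3b _ _) (hA3b _ _)) (inv_nonneg.2 hη.le))
    have hJ3w : ∀ j, j ≤ k → ∀ (μ : Fin d) (x : Site d), ((L : ℝ) ^ j * η) ^ 3 * ‖Jcur η U₀ A3 μ x‖ ≤ Cφ * s := by
      intro j hj μ x
      have hLj : (L : ℝ) ^ j ≤ (L : ℝ) ^ k := pow_le_pow_right₀ hL1r hj
      calc ((L : ℝ) ^ j * η) ^ 3 * ‖Jcur η U₀ A3 μ x‖
          ≤ ((L : ℝ) ^ k * η) ^ 3 * (8 * d * (η⁻¹ * (η⁻¹ * (Wd * s * η⁻¹ + Wd * s * η⁻¹)))) :=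
            mul_le_mul (pow_le_pow_left₀ (by positivity) (mul_le_mul_of_nonneg_right hLj hη.le) 3) (hJ3 μ x) (norm_nonneg _) (by positivity)
        _ = 16 * d * ((L : ℝ) ^ k) ^ 3 * Wd * s := by field_simp; ring
        _ ≤ Cφ * s := mul_le_mul_of_nonneg_right hC16 hs0
    have hiA3 : ∀ (y : Site d) (μ : Fin d), ‖iEta η A3 y μ‖ ≤ Wd * s := fun y μ => by
      rw [iEta, norm_I_eta_smul hη.le]; exact hA3η y μ
    have havg3 : ∀ j, 1 ≤ j → j ≤ k → ∀ c ∈ cubeLamBP L (a + q • v) M ρ k k j, ‖linCovIter L U₀ (iEta η A3) j c.1 c.2‖ ≤ Cφ * s := by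
      intro j hj1 hjk c hc
      calc ‖linCovIter L U₀ (iEta η A3) j c.1 c.2‖ ≤ 2 * d * ((1 + thetaGen d L (cP3 * (L : ℝ) ^ 2)) * (L : ℝ) ^ j) * (Wd * s) :=
            norm_linCovIter_cubeLamBP_le hL2 hρ hcP3pos hcP3Q hU₀ hAkcv hj1 hjk hc (iEta η A3) (mul_nonneg hWd0 hs0) (fun y μ _ => hiA3 y μ)
        _ = 2 * d * ((1 + thetaGen d L (cP3 * (L : ℝ) ^ 2)) * (L : ℝ) ^ j) * Wd * s := by ring
        _ ≤ Cφ * s := mul_le_mul_of_nonneg_right (hC2 j hjk) hs0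
    -- (4) file (U)'s hypotheses for `φ` with the target `N_φ = N + C_φ s`
    have hNφ0 : 0 ≤ N + Cφ * s := by positivity
    have HJ : ∀ j, j ≤ k → ∀ (y : Site d) (τ : Fin d), BondTouches (cubeFam false L (a + q • v) M ρ k j) y τ →
        ((L : ℝ) ^ j * η) ^ 3 * ‖Jcur η U₀ φ τ y‖ ≤ N + Cφ * s := by
      intro j hj y τ hb
      rw [cubeFam_false_of_le L _ M ρ hj] at hb
      have hb0 : BondTouches (cube L (a + q • v) M ρ k 0) y τ := by
        rcases hb with h | h
        exacts [Or.inl (cube_anti (Nat.zero_le j) hj h), Or.inr (cube_anti (Nat.zero_le j) hj h)]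
      have hbΩ : BondTouches (Ω j) y τ := by
        rcases Nat.eq_zero_or_pos j with rfl | hj1'
        · rw [hΩ0]; exact Or.inl (Set.mem_univ y)
        · exact bondTouches_periodize_of_translate a M ρ hq hj1' hj v hb
      have hsplit : Jcur η U₀ (A' - A3) τ y = Jcur η U₀ A' τ y - Jcur η U₀ A3 τ y := by
        rw [eq_sub_iff_add_eq, ← Jcur_add, sub_add_cancel]
      rw [Jcur_congr_fld_touch hb0 hφS', hsplit]
      calc ((L : ℝ) ^ j * η) ^ 3 * ‖Jcur η U₀ A' τ y - Jcur η U₀ A3 τ y‖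
          ≤ ((L : ℝ) ^ j * η) ^ 3 * (‖Jcur η U₀ A' τ y‖ + ‖Jcur η U₀ A3 τ y‖) := mul_le_mul_of_nonneg_left (norm_sub_le _ _) (by positivity)
        _ ≤ N + Cφ * s := by rw [mul_add]; exact add_le_add (hNJ j hj y τ hbΩ) (hJ3w j hj τ y)
    have Havg : ∀ j, j ≤ k → ∀ c ∈ cubeLamBP L (a + q • v) M ρ k k j, ‖linCovIter L U₀ (iEta η φ) j c.1 c.2‖ ≤ N + Cφ * s := by
      intro j hj c hc
      rcases Nat.eq_zero_or_pos j with rfl | hj1'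
      · have hb0 : BondTouches (cube L (a + q • v) M ρ k 0) c.1 c.2 := by obtain ⟨-, hends, -⟩ := hc; exact hends
        have e0 : linCovIter L U₀ (iEta η φ) 0 c.1 c.2 = iEta η A' c.1 c.2 - iEta η A3 c.1 c.2 := by
          show iEta η φ c.1 c.2 = _
          rw [iEta, iEta, iEta, hφS c.1 c.2 (hbt _ _ hb0), smul_sub]
        rw [e0]
        refine (norm_sub_le _ _).trans (add_le_add ?_ ((hiA3 c.1 c.2).trans (mul_le_mul_of_nonneg_right hWdC hs0)))
        exact hNavgL 0 hj c (cubeLamBP_translate_zero_subset_towerBondsP_periodize hL1 a M hρ hq hP hk v hc)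
      · have hjk' : j - 1 ≤ k := by omega
        have e1 : linCovIter L U₀ (iEta η φ) j c.1 c.2 = linCovIter L U₀ (iEta η (A' - A3)) j c.1 c.2 :=
          linCovIter_congr L hL1 j c.1 c.2 (fun _ _ _ _ => rfl) fun z κ hz _ => by
            simp only [iEta, hφS' z κ (hbt _ _ (Or.inl (cube_anti (Nat.zero_le _) hjk'
              (cubeLamBP_box_subset_pred hL1 (a + q • v) M hρ hj1' le_rfl hc z hz))))]
        rw [e1, iEta_sub, linCovIter_sub_cubeLamBP hL2 hρ hcP3pos hcP3Q hU₀ hAkcv hj1' hj hc]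
        refine (norm_sub_le _ _).trans (add_le_add ?_ (havg3 j hj1' hj c hc))
        exact hNavgL j hj c (cubeLamBP_translate_subset_towerBondsP_periodize hL1 a M hρ hq hP v hj1' hj hc)
    have Hout : ∀ (y : Site d) (τ : Fin d), ¬ BondTouches (cubeFam false L (a + q • v) M ρ k 0) y τ → η * ‖φ y τ‖ ≤ N + Cφ * s := by
      intro y τ hnb
      rw [cubeFam_false_zero] at hnb
      by_cases hsd : SideTouches (cube L (a + q • v) M ρ k 0) y τ
      · rw [hφS y τ hsd]
        have h1 : η * ‖A' y τ‖ ≤ N := by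
          rw [← norm_I_eta_smul hη.le]
          have hends := ends_not_mem_cube_one_of_sideTouches a M hq hP hρ1 hk hsd hnb
          exact hNavgL 0 (Nat.zero_le k) (y, τ)
            (mem_towerBondsP_periodize_zero_of_ends a M ρ hq hk (fun w => (hends w).1) fun w => (hends w).2)
        calc η * ‖A' y τ - A3 y τ‖ ≤ η * (‖A' y τ‖ + ‖A3 y τ‖) := mul_le_mul_of_nonneg_left (norm_sub_le _ _) hη.le
          _ ≤ N + Cφ * s := by rw [mul_add]; exact add_le_add h1 ((hA3η y τ).trans (mul_le_mul_of_nonneg_right hWdC hs0))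
      · rw [hφN y τ hsd, norm_zero, mul_zero]; exact hNφ0
    -- (5) the per-member curved (1.59) for `φ`; `A′ = φ + A‴` on the sides
    have hmain := H (a + q • v) η hη U₀ hU₀ Ω k hsub hAk0 φ hLanφ hφ0 (N + Cφ * s) hNφ0 HJ Havg Hout
    have hsf : SideTouches (cubeFam false L (a + q • v) M ρ k j) y τ := by rwa [cubeFam_false_of_le L _ M ρ hjk]
    have hs0 : SideTouches (cube L (a + q • v) M ρ k 0) y τ := sideTouches_mono (cube_anti (Nat.zero_le j) hjk) hs
    have hA'eq : A' y τ = φ y τ + A3 y τ := by rw [hφS y τ hs0, sub_add_cancel]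
    have hA3w : (L : ℝ) ^ j * η * ‖A3 y τ‖ ≤ (L : ℝ) ^ k * (Wd * s) := by
      rw [mul_assoc]; exact mul_le_mul (pow_le_pow_right₀ hL1r hjk) (hA3η y τ) (by positivity) (by positivity)
    calc (L : ℝ) ^ j * η * ‖A' y τ‖ = (L : ℝ) ^ j * η * ‖φ y τ + A3 y τ‖ := by rw [← hA'eq]
      _ ≤ (L : ℝ) ^ j * η * (‖φ y τ‖ + ‖A3 y τ‖) := mul_le_mul_of_nonneg_left (norm_add_le _ _) (by positivity)
      _ ≤ B'' * (N + Cφ * s) + (L : ℝ) ^ k * (Wd * s) := by rw [mul_add]; exact add_le_add (hmain j hjk y τ hsf).1 hA3w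
      _ = B'' * N + (B'' * Cφ + (L : ℝ) ^ k * Wd) * s := by ring
  refine ⟨fun y τ => ?_, fun j hj1 hjk v y τ hs => (LEV v j hj1 hjk y τ hs).trans
    (add_le_add (mul_le_mul_of_nonneg_right hBP hN0) (mul_le_mul_of_nonneg_right hP₁b hs0))⟩
  -- ★ everywhere: a bond touches some translate's `□₁` (per-cube bound at level `1`) or none (level-`0` class bond of `Ω`)
  by_cases hb1 : ∃ v : Site d, BondTouches (cube L (a + q • v) M ρ k 1) y τ
  · obtain ⟨v, hb1⟩ := hb1
    obtain ⟨κ, hκ⟩ := exists_ne_fin hd2 τ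
    have h := LEV v 1 le_rfl hk y τ (sideTouches_of_bondTouches hκ hb1)
    rw [pow_one] at h
    calc η * ‖A' y τ‖ ≤ (L : ℝ) * η * ‖A' y τ‖ := by rw [mul_assoc]; exact le_mul_of_one_le_left (by positivity) hL1r
      _ ≤ B'' * N + (B'' * Cφ + (L : ℝ) ^ k * Wd) * s := h
      _ ≤ P₀ * N + P₁ * s := add_le_add (mul_le_mul_of_nonneg_right hBP hN0) (mul_le_mul_of_nonneg_right hP₁b hs0)
  · push Not at hb1
    have h1 : ∀ w : Site d, y ∉ cube L (a + q • w) M ρ k 1 := fun w h => hb1 w (Or.inl h)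
    have h2 : ∀ w : Site d, y + e τ ∉ cube L (a + q • w) M ρ k 1 := fun w h => hb1 w (Or.inr h)
    have h := hNavgL 0 (Nat.zero_le k) (y, τ) (mem_towerBondsP_periodize_zero_of_ends a M ρ hq hk h1 h2)
    have e0 : linCovIter L U₀ (iEta η A') 0 (y, τ).1 (y, τ).2 = ((Complex.I : ℂ) * η) • A' y τ := rfl
    rw [e0, norm_I_eta_smul hη.le] at h
    calc η * ‖A' y τ‖ ≤ N := h
      _ ≤ P₀ * N := le_mul_of_one_le_left hN0 h1P
      _ ≤ P₀ * N + P₁ * s := le_add_of_nonneg_right (by positivity)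

end Literature.MathematicalPhysics.QuantumFieldTheory.Balaban1983to89.B8Ineq159PeriodizedTowerSourcePoint

end
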